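import Summits.CriticalPhenomena.PercolationContinuityZ3.Theorems.Transplant.SkelWinChainT
import Summits.CriticalPhenomena.PercolationContinuityZ3.Theorems.Transplant.KNCells2CorridorEdgeO
import Summits.CriticalPhenomena.PercolationContinuityZ3.Theorems.Transplant.KNCells2CorridorEdge
import Summits.CriticalPhenomena.PercolationContinuityZ3.Theorems.Transplant.KNCells2Face
import Summits.CriticalPhenomena.PercolationContinuityZ3.Theorems.Transplant.KNCellsSchemeO
import Summits.CriticalPhenomena.PercolationContinuityZ3.Theorems.Transplant.KNCellsProcessO
import Summits.CriticalPhenomena.PercolationContinuityZ3.Theorems.Transplant.KNCells2SchemeO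
import Summits.CriticalPhenomena.PercolationContinuityZ3.Theorems.Transplant.KNCellsStepsDefsO
import Summits.CriticalPhenomena.PercolationContinuityZ3.Theorems.Transplant.KNCellsStepsReachO
import Summits.CriticalPhenomena.PercolationContinuityZ3.Theorems.Transplant.KNCellsStepsPinO
import Summits.CriticalPhenomena.PercolationContinuityZ3.Theorems.Transplant.KNCellsStepsSubboxO
import Summits.CriticalPhenomena.PercolationContinuityZ3.Theorems.Transplant.KNCells2CorridorO
import Summits.CriticalPhenomena.PercolationContinuityZ3.Theorems.Transplant.SkelWinPackaging
import Literature.Probability.Percolation.OrientedHistorySiteRenormalizationRun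
import HarnessLib

/-!
# N2 (frames-only node `SamePDropOfSkeletonFrm₁`, OPEN) — ORIENTED MACRO LAYER (WAVE 0 (c1), (R-18) `q ≡ true`): the oriented twin of N1's `SkelWinPackaging`

builds on p205010 (kernel theorem, internal audit signed; external expert review pending) — nothing in this file uses p205010; NOTHING is claimed about the
open node `SamePDropOfSkeletonFrm₁` (`SamePDropOfSkeletonNeg₁` is CLOSED in the tree and untouched by this file).
Status sentence (coordinator 2026-08-20T04:30Z): "θ(p_c) = 0 on ℤ^d, all d ≥ 2 — kernel-verified (Lean 4/Mathlib, standard axioms); internal adversarial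
audit SIGNED 2026-08-20 04:29Z; external expert review pending."
Lane `prim-bschramm-*`, seat `prim-bschramm-stmt` (gen 19); helper file (`--supports stmt-CriticalPhenomena-4575 --as helper`); N2-SCOPE §20, (R-18)/(R-19).
PORT RULES (HOME/prim-bschramm-stmt-g19/lean/port_orient.py): the history-site API is replaced by its ORIENTED twin at the fixed quadrant `qNE := fun _ => true`
(`HState.choice ↦ HState.ochoice qNE`, `mstOf ↦ omstOf qNE`, `mst/stN ↦ omst/ostN qNE`, `occFinal ↦ ooccFinal qNE`, `Lawful ↦ OLawful qNE`, onward directions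
`onward ↦ onwardO` = the POSITIVE ones, (N2-e)); every declaration whose text changes thereby — directly or through a changed declaration — is re-declared with the
suffix `O` (same namespace); unchanged declarations of the N1 file are NOT repeated (the N1 module is imported). Docstrings/citations are N1's.
N1 HEADER (kept for the reader):
* **`Skel.hreach_of_winChain`** — after a valid history, the chain property for the window graph (stmt's `Φ.chain_edge_UP` at `G' = winGraph …`),
  per step the kit clause + subbox + support facts + the rim excess `P_{Wcor}(root ↔ Rim_i) ≤ η ≤ δ/2`, the arrival cube inside `X^{(0)}_0` and the
  last true target inside `M^{a'}_{x+du}` give `1 - ε'' < P_{Wfull}(Reach h e (aOf₁) a' du)`;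
* **`Skel.cond_of_winStep`** — one window step whose first level contains the face `F^{j+1}`, true target `T' ⊆ M^{a'}_{x+du}` inside the
  enlarged target, excess `≤ η ≤ δc/2`, turns `1 - δ₂ < P_{Wt}(root ↔ F^{j+1})` into `cond`.
[cite: KozmaNitzan2024, §4 p. 30 (Steps III–IV), Lemma 10 (p. 17), Lemma 12 (pp. 23–25)]
-/
noncomputable section

open MeasureTheory ProbabilityTheory
open scoped ENNReal Classical

namespace Summit.CriticalPhenomena.PercolationContinuityZ3.Theorems

namespace Transplant

namespace Skel

open Literature.Probability.Percolation Literature.Probability.LatticeModels SimpleGraph KNCells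
open GadgetSystem ProbeHistory HSiteScheme Contour

variable {V : Type} [DecidableEq V] [Countable V] {G : SimpleGraph V} [G.LocallyFinite] (Φ : PlanarSkeletonConc G)
variable {A : Type*} {S : KSchA V A} {FD : FaceData V A}
variable {h : ProbeHistory V} {e : Site 2 × MDir} {a a' : A} {du : MDir}

/-- **`hreach` FROM A WINDOW CORRIDOR CHAIN** (generic design (D)). [cite: KozmaNitzan2024, §4 Lemma 12 (pp. 23–25), p. 30 (Step IV)] -/
theorem hreach_of_winChainO (P : WinChainData V) (hV : S.Valid₂O G h e) {Δ' : ℕ} {δ ε'' η : ℝ}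
    (hδc : S.δc ≤ δ)
    (hchain : ∀ (Wg : Sym2 V → unitInterval) (s : Fin (ChainPlanar.Sched.nLast + 1) → KNLevels.TStep (winGraph G P.root P.Rπ))
      (T' : Fin (ChainPlanar.Sched.nLast + 1) → Finset V) (η : ℝ),
      (∀ i, (s i).L.o = (s 0).L.o) →
      (∀ i : Fin ChainPlanar.Sched.nLast, T' (Fin.castSucc i) ⊆ (s i.succ).L.X 0) →
      (∀ i, T' i ⊆ (s i).T) →
      (∀ i, (s i).KitsAt Wg S.p Δ' δ) →
      η ≤ δ / 2 →
      (∀ i, (prodBernoulli Wg).real (⋃ t ∈ (s i).T \ T' i, openConn (s 0).L.o t) ≤ η) →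
      1 - δ < (prodBernoulli Wg).real (s 0).L.reachB →
        1 - ε'' < (prodBernoulli Wg).real (⋃ t ∈ T' (Fin.last ChainPlanar.Sched.nLast), openConn (s 0).L.o t))
    (hroot : P.root = S.Γ.root)
    (hr : P.C.r = 4 * P.t) (hR : 100 * P.R' ≤ P.t) (hRl : P.Rlev + 1 ≤ P.R') (hRim : ∀ i, P.Rim i ⊆ P.stepD Φ i)
    (hTne : ∀ i ≤ ChainPlanar.Sched.nLast, (P.tgtT Φ i).Nonempty)
    (hj : P.j₁ ≤ P.Rlev) (hcount : 1 / (1 - (S.p : ℝ)) ^ (Δ' * P.N) ≤ δ * ((Finset.Icc P.j₀ P.j₁).card : ℝ))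
    (hsub : ∀ i ≤ ChainPlanar.Sched.nLast,
      KNLevels.IsSubbox (winGraph G P.root P.Rπ) (S.Wcor G FD h e (S.aOf₁O G h e) a' du) S.p (P.stepD Φ i))
    (hfin : KNLevels.FinSupp (S.Wcor G FD h e (S.aOf₁O G h e) a' du) P.Sfin)
    (hDS : ∀ i ≤ ChainPlanar.Sched.nLast, P.stepD Φ i ⊆ P.Sfin) (ho : ∀ i ≤ ChainPlanar.Sched.nLast, P.root ∉ P.stepD Φ i)
    (hoS : P.root ∈ P.Sfin)
    (hkits : ∀ i ≤ ChainPlanar.Sched.nLast, ∀ j ∈ Finset.Icc P.j₀ P.j₁,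
      ∃ (σ : KNLevels.SData V) (Sz : Finset V),
      KNLevels.SHyp (winLData Φ P.root P.Rπ (P.lo i) (P.hi i) P.root P.Sfin) j σ ∧ σ.N ≤ P.N ∧
      (1 - (S.p : ℝ) ^ σ.sB) ^ σ.k ≤ δ ∧ Sz ⊆ (winLData Φ P.root P.Rπ (P.lo i) (P.hi i) P.root P.Sfin).X j ∧ Sz ⊆ P.stepD Φ i ∧
      (∀ x ∈ σ.K, ∀ e' ∈ σ.seed x, e' ∉ wireSet (↑Sz : Set V)) ∧ (∀ x ∈ σ.K, σ.face x ⊆ Sz) ∧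
      (∀ x ∈ σ.K, 1 - 3 * δ ≤ (prodBernoulli (S.Wcor G FD h e (S.aOf₁O G h e) a' du)).real {ω | ∃ u ∈ σ.face x,
        1 - δ < (prodBernoulli (pinW (S.Wcor G FD h e (S.aOf₁O G h e) a' du) (wireSet (↑Sz : Set V)) ω)).real
          (⋃ t ∈ P.tgtE Φ i, openConnIn (↑(P.stepD Φ i) : Set V) u t)}))
    (hη : η ≤ δ / 2)
    (hexc : ∀ i ≤ ChainPlanar.Sched.nLast, (prodBernoulli (S.Wcor G FD h e (S.aOf₁O G h e) a' du)).real
      (⋃ t ∈ P.Rim i, openConn S.Γ.root t) ≤ η)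
    {R₀ : ℕ} (hR₀ : R₀ ≤ P.Rπ) (hM0 : S.Γ.M (S.aOf₁O G h e) (tgt e) ⊆ Φ.Win P.root (P.C.M P.x) R₀)
    (hMn : Φ.Win P.root (P.C.M (P.x + stepVec P.du) ∩ P.C.Hfull P.x P.du) P.Rπ ⊆ S.Γ.M a' (tgt e + stepVec du)) :
    1 - ε'' < (prodBernoulli (S.Wfull G h e (S.aOf₁O G h e) a' du)).real (S.Reach G FD h e (S.aOf₁O G h e) a' du) := by
  -- the chain as `Fin (nLast + 1)`-indexed target steps
  let s : Fin (ChainPlanar.Sched.nLast + 1) → KNLevels.TStep (winGraph G P.root P.Rπ) := fun i => P.stepE Φ i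
  let T' : Fin (ChainPlanar.Sched.nLast + 1) → Finset V := fun i => P.tgtT Φ i
  have hle : ∀ i : Fin (ChainPlanar.Sched.nLast + 1), (i : ℕ) ≤ ChainPlanar.Sched.nLast := fun i => Nat.lt_succ_iff.1 i.2
  refine KSchA.hreach_of_chain_edge_subO (winGraph G P.root P.Rπ) hV hδc hchain s T' (fun i => ?_) (fun i => ?_) (fun i => ?_)
    (fun i => ?_) hη (fun i => ?_) ?_ ?_
  · show (P.stepE Φ i).L.o = S.Γ.root
    rw [WinChainData.stepE_o, hroot]
  · show P.tgtT Φ (Fin.castSucc i) ⊆ (P.stepE Φ i.succ).L.X 0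
    have : ((i.succ : Fin (ChainPlanar.Sched.nLast + 1)) : ℕ) = (Fin.castSucc i : ℕ) + 1 := by simp
    rw [show P.stepE Φ (i.succ : ℕ) = P.stepE Φ ((Fin.castSucc i : ℕ) + 1) by rw [this]]
    exact P.tgtT_subset_X_zero_succ Φ _
  · exact P.tgtT_subset_tgtE Φ i
  · exact WinChainData.kitsAt_stepE Φ hR hRl hRim (hle i) (hTne i (hle i)) (hsub i (hle i)) hfin (hDS i (hle i)) (ho i (hle i)) hoS hj
      hcount (hkits i (hle i))
  · refine le_trans (measureReal_mono ?_ (measure_ne_top _ _)) (hexc i (hle i))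
    intro ω hω
    simp only [Set.mem_iUnion, exists_prop] at hω ⊢
    obtain ⟨t, ht, hωt⟩ := hω
    exact ⟨t, P.tgtE_sdiff_subset Φ i ht, hωt⟩
  · -- the arrival cube lies in the first core
    show S.Γ.M (S.aOf₁O G h e) (tgt e) ⊆ (P.stepE Φ ((0 : Fin (ChainPlanar.Sched.nLast + 1)) : ℕ)).L.X 0
    exact hM0.trans (WinChainData.cube_subset_X_zero Φ hr hR hR₀)
  · -- the last true target lies in `M_{x+du}`
    show P.tgtT Φ ((Fin.last ChainPlanar.Sched.nLast : Fin _) : ℕ) ⊆ S.Γ.M a' (tgt e + stepVec du)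
    rw [Fin.val_last]
    exact (WinChainData.tgtT_last_subset Φ hr hR).trans hMn

end Skel

end Transplant

end Summit.CriticalPhenomena.PercolationContinuityZ3.Theorems

end
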